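import Summits.BirchSwinnertonDyer.BirchSwinnertonDyer.Theorems.RamifiedSevenEllipticUnitsIndexIffControl
import Summits.BirchSwinnertonDyer.BirchSwinnertonDyer.Theorems.RamifiedSevenEllipticUnitsAssemblyNoFrame
import Literature.NumberTheory.EllipticCurves.BSDSelmerCMPConverseMaximalOrderProofs
import HarnessLib

set_option linter.dupNamespace false
set_option autoImplicit false

/-!
# Route `RamifiedSevenEllipticUnits` (rung K7r): the crux `EllipticUnitIndexSeven`
# (stmt-BirchSwinnertonDyer-19143) is EXACTLY the rung leaf `X12.CMRamifiedSeven` modulo the two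
# other cruxes — support lemmas (`--supports 19143`)

Cell `bsd-cm`, seat `bsd-cm-k7r-c2` (g0). HONEST FRAMING: nothing here closes the crux or the leaf.
What is proved is the exact logical position of crux #2 `(R-EU)@7` inside the route, in the kernel:

* §1 `classCSeven_of_isIsogenous` / `classCSeven_iff_of_isIsogenous`: the class 𝒞₇
  (`X12.ClassCSeven`: CM by `ℚ(√−7)`, analytic rank one, good ordinary reduction at `2`, every bad
  prime `q ≠ 7` split in `K`) is a property of the `ℚ`-ISOGENY CLASS of a globally minimal curve —
  CM and the CM field (`X12.hasCM_of_isIsogenous`, `X12.cmFieldDiscrOfJ_eq_of_isIsogenous`), the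
  analytic rank (`analyticRank_eq_of_isIsogenous'`), good reduction (Serre–Tate,
  `IsIsogenous.hasGoodReductionAtPrime_iff`) and `a_2` (Faltings, `frobeniusTrace_eq_of_isIsogenous`)
  are isogeny invariants; in particular every frame twin `W' ≅ W^{(−7)}` of a member is a member
  (`classCSeven_of_isFrame`, via ram's `isIsogenous_of_isFrame`).
* §2 `ellipticUnitIndexSeven_of_strictControlSeven_of_forall_bsdp_seven`: `(R-ctrl)@7` on 𝒞₇
  together with `BSD(E, 7)` for every globally minimal member GIVES `(R-EU)@7` on 𝒞₇ — the
  isogeny-class hypothesis of p409726's `ellipticUnitIndexAt_of_strictControlAt_of_bsdp_isogenyClass`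
  is discharged by §1 (an isogenous minimal curve is again a member). Hence
  `ellipticUnitIndexSeven_of_strictControlSeven_of_cmRamifiedSeven`: `StrictControlSeven →
  X12.CMRamifiedSeven → EllipticUnitIndexSeven`.
* §3 `ellipticUnitIndexSeven_iff_cmRamifiedSeven`: GIVEN the two other cruxes `StrictTorsionSeven`
  (19144), `StrictControlSeven` (19145) and the published facts `PublishedFactsSeven` (19147),
  `EllipticUnitIndexSeven ↔ X12.CMRamifiedSeven` (→ is ram's `cmRamifiedSeven_of_cruxes`, p411081);
  equivalently (`ellipticUnitIndexSeven_iff_forall_bsdp_seven`) `↔ ∀ W ∈ 𝒞₇, BSD(W, 7)`; and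
  symmetrically `strictControlSeven_iff_cmRamifiedSeven` given 19143, 19144, 19147.

CONSEQUENCE FOR THE ROUTE (a remark for the planner / tribunal, not a closing). The decomposition
`leaf ⇐ (R-EU) ∧ (R-tors) ∧ (R-ctrl) ∧ facts` loses NOTHING at crux #2: modulo the two `L`-sized
cruxes (which the O11 memo derives from Greenberg–Wiles + GZK + the Euler-characteristic lemma) and
the published facts, `EllipticUnitIndexSeven` is neither stronger nor weaker than the rung leaf
`BSD(E, p) ∀ E ∈ 𝒞₇ ∀ p`, i.e. than `BSD(E, 7)` on the INFINITE class 𝒞₇. So (i) crux #2 cannot be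
refuted without refuting BSD₇ on 𝒞₇ or `(R-ctrl)@7` (the route file's "why it might fail" — a power
of `7` lost in the index-to-`L`-value specialisation — concerns the PROOF ROUTE via Rubin's main
conjecture, not the typed statement); (ii) it cannot be "found" short of the ramified-prime value
formula (★_an) for every member, which is not in print (Burungale–Kobayashi–Nakamura–Ota,
arXiv:2608.06879 §1.4 p. 8: "the ramified counterparts of these problems [BDP-type formula,
`p`-converse], on which we will report elsewhere"); (iii) per-member certificates (Route U) prove
instances of the right-hand side `BSD(W, 7)`, never the class statement. The separating BC5/t3
witness of the route stays the relative one (`stub_ellipticUnitIndexSeven_D11`, p413532).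
Nothing is asserted; no named fact is minted.

References: [Miller2011LMS] Def. 1.1; [SilvermanAEC2009] Cor. VII.7.2, Ex. 5.4;
[Faltings1983Endlichkeit] §5 Kor. 2; [SilvermanAdvancedTopics1994] Ex. 2.12(b), App. A §3;
[BurungaleKobayashiNakamuraOta2026] Thm. 3.14 (3), §1.4 (shape only; preprint).
-/

noncomputable section

open scoped Classical

open WeierstrassCurve NumberField IsDedekindDomain
  Literature.NumberTheory.EllipticCurves
  Literature.NumberTheory.EllipticCurves.Rank1Residual
  Summit.BirchSwinnertonDyer.Rank1Residual.X12
  Summit.BirchSwinnertonDyer.Rank1Residual.X12.O11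
  Summit.BirchSwinnertonDyer.BirchSwinnertonDyer.Theses.RamifiedSevenEllipticUnits

namespace Summit.BirchSwinnertonDyer.BirchSwinnertonDyer.Theorems.RamifiedSevenEllipticUnits

/-! ## §1 The class 𝒞₇ is a property of the `ℚ`-isogeny class -/

section Isogeny

variable {W W' : WeierstrassCurve ℚ} [W.IsElliptic] [W'.IsElliptic] [W.IsGloballyMinimal]
  [W'.IsGloballyMinimal]

/-- **𝒞₇ is closed under `ℚ`-isogeny of globally minimal models.** If `W ∼ W'` over `ℚ` and
`W ∈ 𝒞₇` then `W' ∈ 𝒞₇`: CM transports (`hasCM_of_isIsogenous`), the CM field is an isogeny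
invariant (`cmFieldDiscrOfJ_eq_of_isIsogenous`), the analytic rank is (equal `L`-functions,
`analyticRank_eq_of_isIsogenous'`), good reduction at `2` is (Serre–Tate,
`IsIsogenous.hasGoodReductionAtPrime_iff`) and so is `2 ∤ a_2` (Faltings,
`IsIsogenous.not_dvd_frobeniusTrace_iff`); a bad prime `q ≠ 7` of `W'` is bad for `W`, hence split
in the common CM field (`cmSplit_iff_of_isIsogenous`). [cite: SilvermanAEC2009, Cor. VII.7.2 and Ex. 5.4]
[cite: SilvermanAdvancedTopics1994, Exercise 2.12(b) and App. A §3 (p. 483)] -/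
theorem classCSeven_of_isIsogenous (h : IsIsogenous W W') (hC : ClassCSeven W) : ClassCSeven W' := by
  obtain ⟨hCM, hd, hr, hgo, hsplit⟩ := hC
  refine ⟨hasCM_of_isIsogenous h hCM, ?_, ?_, ?_, ?_⟩
  · rw [← cmFieldDiscrOfJ_eq_of_isIsogenous h hCM]
    exact hd
  · rw [← analyticRank_eq_of_isIsogenous' h]
    exact hr
  · exact ⟨(h.hasGoodReductionAtPrime_iff 2).mp hgo.1,
      (h.not_dvd_frobeniusTrace_iff 2 hgo.1).mp hgo.2⟩
  · intro q _ hq7 hng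
    have hngW : ¬ Good W q := fun hg => hng ((h.hasGoodReductionAtPrime_iff q).mp hg)
    exact (cmSplit_iff_of_isIsogenous h hCM q).mp (hsplit q hq7 hngW)

/-- `W ∈ 𝒞₇ ↔ W' ∈ 𝒞₇` for `ℚ`-isogenous globally minimal `W, W'`.
[cite: SilvermanAEC2009, Cor. VII.7.2 and Ex. 5.4] -/
theorem classCSeven_iff_of_isIsogenous (h : IsIsogenous W W') : ClassCSeven W ↔ ClassCSeven W' :=
  ⟨classCSeven_of_isIsogenous h, classCSeven_of_isIsogenous h.symm_of_charZero⟩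

/-- **A frame twin of a 𝒞₇ member is a 𝒞₇ member**: if `O11.IsFrame W p K 𝔭 W' C` (so `W'` is a
globally minimal model of `W^{(d_K)} = W^{(−7)}`) and `W ∈ 𝒞₇`, then `W' ∈ 𝒞₇` — by
`isIsogenous_of_isFrame` (p409726) and `classCSeven_of_isIsogenous`.
[cite: SilvermanAdvancedTopics1994, Exercise 2.12(b) and App. A §3 (p. 483)] -/
theorem classCSeven_of_isFrame {p : ℕ} {K : Type} [Field K] [NumberField K]
    {𝔭 : HeightOneSpectrum (𝓞 K)} {C : VariableChange ℚ} (hF : IsFrame W p K 𝔭 W' C)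
    (hC : ClassCSeven W) : ClassCSeven W' :=
  classCSeven_of_isIsogenous (isIsogenous_of_isFrame hF) hC

end Isogeny

/-! ## §2 The leaf (at `7`) and `(R-ctrl)@7` give `(R-EU)@7` on 𝒞₇ -/

/-- **`(R-ctrl)@7` on 𝒞₇ ∧ `BSD(E, 7)` for every globally minimal member ⟹ `(R-EU)@7` on 𝒞₇.**
For a member `W`, every globally minimal `V` isogenous to `W` is again a member (§1), so `BSD(V, 7)`
holds by hypothesis, and p409726's `ellipticUnitIndexAt_of_strictControlAt_of_bsdp_isogenyClass`
applies. [cite: Miller2011LMS, Def. 1.1 (arXiv:1010.2431 p. 3)] -/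
theorem ellipticUnitIndexSeven_of_strictControlSeven_of_forall_bsdp_seven (h₃ : StrictControlSeven)
    (h7 : ∀ (W : WeierstrassCurve ℚ) [W.IsElliptic] [W.IsGloballyMinimal],
      ClassCSeven W → BSDp W 7) :
    EllipticUnitIndexSeven := by
  intro W _ _ _ hC
  exact ellipticUnitIndexAt_of_strictControlAt_of_bsdp_isogenyClass (h₃ W hC)
    fun V _ _ hiso => h7 V (classCSeven_of_isIsogenous hiso hC)

/-- **`StrictControlSeven → X12.CMRamifiedSeven → EllipticUnitIndexSeven`**: the rung leaf K7r
(`BSD(E, p)` for every `E ∈ 𝒞₇` and every prime `p`), read at `p = 7`, together with crux #4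
`(R-ctrl)@7` gives crux #2 `(R-EU)@7`. [cite: Miller2011LMS, Def. 1.1 (arXiv:1010.2431 p. 3)] -/
theorem ellipticUnitIndexSeven_of_strictControlSeven_of_cmRamifiedSeven (h₃ : StrictControlSeven)
    (hleaf : Summit.BirchSwinnertonDyer.Rank1Residual.X12.CMRamifiedSeven) :
    EllipticUnitIndexSeven :=
  ellipticUnitIndexSeven_of_strictControlSeven_of_forall_bsdp_seven h₃
    fun W _ _ hC => hleaf W hC 7 (by norm_num)

/-- Symmetrically, **`EllipticUnitIndexSeven → X12.CMRamifiedSeven → StrictControlSeven`** (the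
converse arithmetic, p409726's `strictControlAt_of_ellipticUnitIndexAt_of_bsdp_isogenyClass`, with
the isogeny-class hypothesis discharged by §1). [cite: Miller2011LMS, Def. 1.1 (arXiv:1010.2431 p. 3)] -/
theorem strictControlSeven_of_ellipticUnitIndexSeven_of_cmRamifiedSeven (h₁ : EllipticUnitIndexSeven)
    (hleaf : Summit.BirchSwinnertonDyer.Rank1Residual.X12.CMRamifiedSeven) :
    StrictControlSeven := by
  intro W _ _ _ hC
  exact strictControlAt_of_ellipticUnitIndexAt_of_bsdp_isogenyClass (h₁ W hC)
    fun V _ _ hiso => hleaf V (classCSeven_of_isIsogenous hiso hC) 7 (by norm_num)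

/-! ## §3 Crux #2 is the leaf, modulo cruxes #3, #4 and the published facts -/

/-- **`EllipticUnitIndexSeven ↔ X12.CMRamifiedSeven` given `StrictTorsionSeven`,
`StrictControlSeven`, `PublishedFactsSeven`.** (→) is the route's composition without a frame-data
item (`cmRamifiedSeven_of_cruxes`, p411081: consumer `O11.bsdp_of_halves` at `7` + the `p ≠ 7` facts);
(←) is §2. So modulo the two `L`-cruxes and the named facts, crux #2 of route
`RamifiedSevenEllipticUnits` carries EXACTLY the content of the rung leaf — no more (it is not a
strengthening that could fail while BSD₇ holds) and no less. A remark on the route's structure;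
closes nothing. [cite: Miller2011LMS, Def. 1.1 (arXiv:1010.2431 p. 3)]
[cite: BurungaleKobayashiNakamuraOta2026, Thm. 3.14 (3) and §1.4 (arXiv:2608.06879 pp. 24, 8) (shape only)] -/
theorem ellipticUnitIndexSeven_iff_cmRamifiedSeven (h₂ : StrictTorsionSeven) (h₃ : StrictControlSeven)
    (h₅ : PublishedFactsSeven) :
    EllipticUnitIndexSeven ↔ Summit.BirchSwinnertonDyer.Rank1Residual.X12.CMRamifiedSeven :=
  ⟨fun h₁ => cmRamifiedSeven_of_cruxes h₁ h₂ h₃ h₅,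
    ellipticUnitIndexSeven_of_strictControlSeven_of_cmRamifiedSeven h₃⟩

/-- **`EllipticUnitIndexSeven ↔ (BSD(E, 7) for every globally minimal `E ∈ 𝒞₇`)`** given
`StrictTorsionSeven`, `StrictControlSeven`, `PublishedFactsSeven`: the crux in Miller's currency at
the single prime `7` (the leaf's `p ≠ 7` clauses are the published facts,
`ClassCSeven.forall_bsdp_iff_bsdp_seven`). [cite: Miller2011LMS, Def. 1.1 (arXiv:1010.2431 p. 3)] -/
theorem ellipticUnitIndexSeven_iff_forall_bsdp_seven (h₂ : StrictTorsionSeven)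
    (h₃ : StrictControlSeven) (h₅ : PublishedFactsSeven) :
    EllipticUnitIndexSeven ↔
      ∀ (W : WeierstrassCurve ℚ) [W.IsElliptic] [W.IsGloballyMinimal], ClassCSeven W → BSDp W 7 :=
  ⟨fun h₁ W _ _ hC => cmRamifiedSeven_of_cruxes h₁ h₂ h₃ h₅ W hC 7 (by norm_num),
    ellipticUnitIndexSeven_of_strictControlSeven_of_forall_bsdp_seven h₃⟩

/-- Symmetric reading for crux #4: **`StrictControlSeven ↔ X12.CMRamifiedSeven`** given
`EllipticUnitIndexSeven`, `StrictTorsionSeven`, `PublishedFactsSeven`.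
[cite: Miller2011LMS, Def. 1.1 (arXiv:1010.2431 p. 3)] -/
theorem strictControlSeven_iff_cmRamifiedSeven (h₁ : EllipticUnitIndexSeven) (h₂ : StrictTorsionSeven)
    (h₅ : PublishedFactsSeven) :
    StrictControlSeven ↔ Summit.BirchSwinnertonDyer.Rank1Residual.X12.CMRamifiedSeven :=
  ⟨fun h₃ => cmRamifiedSeven_of_cruxes h₁ h₂ h₃ h₅,
    strictControlSeven_of_ellipticUnitIndexSeven_of_cmRamifiedSeven h₁⟩

end Summit.BirchSwinnertonDyer.BirchSwinnertonDyer.Theorems.RamifiedSevenEllipticUnits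

end
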